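import Mathlib.Data.Nat.Choose.Sum
import Summits.CriticalPhenomena.PercolationContinuityZ3.Theorems.PercNearOneGluingNoHeavyLowerTailSahiCombHybridCoeff

/-!
# The comb hierarchy for Sahi's `E_k`: the hybrid kernel IS Sahi's functional (Möbius weights); the kernel at `k = 3`
# in closed form; hybrids of singletons, pairs and the full block

Support file of the one-cut programme (crux `NoHeavyLowerTail`, stmt-CriticalPhenomena-4575; cell `prim-masterthm`, seat P5 gen 8;
report `P5-LORENTZIAN-TEST.md` §10.1, §10.3, §13).  Companion of `…SahiCombHybridKernel` / `…SahiCombHybridCoeff` (gen 5), which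
construct the (M⁺⁺-k) coefficients `SahiHybrid.hybCoeff E U s = Σ_{fibre(s)} kernel E U ξ` with
`kernel E U ξ = Σ_π (−1)^{|π|−1} ∏_{B∈π} (|B|−1)!·∏_{i∈B} 1_{U_i}(hybrid_B ξ)` (Sahi's set-partition formula [Sahi 2008, eq. (7)]
evaluated block by block on the hybrid configurations).  To EVALUATE the kernel one needs the sum over the set partitions of
`Fin k` (Mathlib `OrderedFinpartition k`).  This file avoids any enumeration:

* `SahiHybrid.coordInd`, `SahiHybrid.mobius`, **`ex_mobius_prod_coordInd`** — Möbius inversion on the cube `Finset κ`: for EVERY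
  set function `G`, the signed weight `mobius G` on `Finset κ` has mixed moments `E[∏_{i∈B} χ_i] = G(B)` of the coordinate
  indicators `χ_i(A) = [i ∈ A]`, for every `B`;
* `SahiHybrid.blockFun E U ξ B = ∏_{i∈B} 1_{U_i}(hybrid E B ξ)` and **`kernel_eq_sahiE`**: for every `k`,
  `kernel E U ξ = E_k(mobius (blockFun E U ξ); χ_0,…,χ_{k−1})` — the hybrid kernel at a copy array is the tree's recursive `sahiE`
  of the coordinate indicators under the Möbius weight of its block functional (via the tree's `sahiE_eq_sahiESetPartition`);
* **`SahiHybrid.kernel_three`** — hence at `k = 3`, by the closed form `sahiE_three_apply`,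
  `kernel = 2·G(⊤) + G{0}G{1}G{2} − (G{0}·G{1,2} + G{1}·G{0,2} + G{2}·G{0,1})`, `G = blockFun E U ξ`;
* `SahiHybrid.hybrid_singleton`, `hybrid_pair`, `hybrid_univ_three` — the hybrid configurations of the blocks of `Fin 3` in closed
  form (the block reads each coordinate from the copy of its LARGEST interested member).
These are the generic inputs of the class-T bridge (`…SahiCombTriangleBridge`: `hybCoeff = TRI` on the triangle class, report §10.3).
Everything here is proved; axioms standard.  HONEST LABEL: identities; (M⁺⁺-3)/`C_3` stay OPEN. [this work]
-/

noncomputable section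

open scoped Classical

namespace Summit.CriticalPhenomena.PercolationContinuityZ3.Theorems

open Finset Function
open Literature.Combinatorics.Sahi2008
open Literature.Combinatorics.Sahi2008.PartitionForm (block mem_block card_block term factor)
open Literature.Probability.Percolation.DecisionTree (ind ind_of_mem ind_of_not_mem ind_nonneg)
open SahiComb

namespace SahiHybrid

variable {ι : Type} {k : ℕ}

/-! ### Möbius weights on the cube `Finset κ` -/

section Mobius

variable {κ : Type} [Fintype κ]

/-- The coordinate indicator `χ_i(A) = [i ∈ A]` on the cube `Finset κ`. [folklore] -/
def coordInd (i : κ) (A : Finset κ) : ℝ := if i ∈ A then 1 else 0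

/-- The **Möbius weight** of a set function `G` on the cube: `mobius G A = Σ_{B ⊇ A} (−1)^{|B∖A|} G(B)`. [folklore] -/
def mobius (G : Finset κ → ℝ) (A : Finset κ) : ℝ :=
  ∑ B ∈ univ.filter (fun B => A ⊆ B), (-1 : ℝ) ^ (B \ A).card * G B

omit [Fintype κ] in
/-- A product of coordinate indicators is the indicator of a principal up-set: `(∏_{i∈B} χ_i)(A) = [B ⊆ A]`. [folklore] -/
theorem prod_coordInd_apply (B A : Finset κ) : (∏ i ∈ B, coordInd i) A = if B ⊆ A then 1 else 0 := by
  rw [Finset.prod_apply]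
  unfold coordInd
  rw [prod_ite_zero, prod_const_one]
  by_cases h : B ⊆ A
  · rw [if_pos h, if_pos fun i hi => h hi]
  · rw [if_neg h, if_neg fun h' => h fun i hi => h' i hi]

omit [Fintype κ] in
/-- The alternating sum over a powerset, in `ℝ`: `Σ_{m ⊆ x} (−1)^{|m|} = [x = ∅]`. [folklore] -/
theorem sum_powerset_neg_one_pow_card_real' (x : Finset κ) :
    (∑ m ∈ x.powerset, (-1 : ℝ) ^ m.card) = if x = ∅ then 1 else 0 := by
  have h := Finset.sum_powerset_neg_one_pow_card (x := x)
  have h' : ((∑ m ∈ x.powerset, (-1 : ℤ) ^ m.card : ℤ) : ℝ) = ((if x = ∅ then 1 else 0 : ℤ) : ℝ) := by rw [h]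
  push_cast at h'
  rw [h']

/-- **Möbius inversion on the cube**: the mixed moments of the coordinate indicators under the Möbius weight of `G` are `G`:
`E_{mobius G}[∏_{i∈B} χ_i] = Σ_{A ⊇ B} mobius G A = G(B)` for every `B`. [folklore] -/
theorem ex_mobius_prod_coordInd (G : Finset κ → ℝ) (B : Finset κ) : ex (mobius G) (∏ i ∈ B, coordInd i) = G B := by
  rw [ex_def]
  simp_rw [prod_coordInd_apply, mul_ite, mul_one, mul_zero]
  -- `Σ_{A ⊇ B} mobius G A = Σ_C G(C) · Σ_{B ⊆ A ⊆ C} (−1)^{|C∖A|}`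
  have h1 : ∑ A : Finset κ, (if B ⊆ A then mobius G A else 0)
      = ∑ A : Finset κ, ∑ C : Finset κ, (if B ⊆ A ∧ A ⊆ C then (-1 : ℝ) ^ (C \ A).card * G C else 0) := by
    refine sum_congr rfl fun A _ => ?_
    by_cases hBA : B ⊆ A
    · rw [if_pos hBA]
      unfold mobius
      rw [sum_filter]
      refine sum_congr rfl fun C _ => ?_
      by_cases hAC : A ⊆ C
      · rw [if_pos hAC, if_pos ⟨hBA, hAC⟩]
      · rw [if_neg hAC, if_neg fun h => hAC h.2]
    · rw [if_neg hBA]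
      symm
      exact sum_eq_zero fun C _ => if_neg fun h => hBA h.1
  rw [h1, sum_comm]
  -- inner sum for fixed `C`
  have h2 : ∀ C : Finset κ, ∑ A : Finset κ, (if B ⊆ A ∧ A ⊆ C then (-1 : ℝ) ^ (C \ A).card * G C else 0)
      = if B = C then G C else 0 := by
    intro C
    by_cases hBC : B ⊆ C
    · -- reindex `A ↦ C \ A`, a bijection from `[B, C]` onto the powerset of `C \ B`
      have h3 : ∑ A : Finset κ, (if B ⊆ A ∧ A ⊆ C then (-1 : ℝ) ^ (C \ A).card * G C else 0)
          = ∑ A ∈ univ.filter (fun A => B ⊆ A ∧ A ⊆ C), (-1 : ℝ) ^ (C \ A).card * G C := by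
        rw [sum_filter]
      have h4 : ∑ A ∈ univ.filter (fun A => B ⊆ A ∧ A ⊆ C), (-1 : ℝ) ^ (C \ A).card * G C
          = ∑ D ∈ (C \ B).powerset, (-1 : ℝ) ^ D.card * G C := by
        refine Finset.sum_nbij' (fun A => C \ A) (fun D => C \ D) ?_ ?_ ?_ ?_ ?_
        · intro A hA
          rw [mem_filter] at hA
          rw [mem_powerset]
          exact sdiff_subset_sdiff (Subset.refl C) hA.2.1
        · intro D hD
          rw [mem_powerset] at hD
          rw [mem_filter]
          refine ⟨mem_univ _, ?_, sdiff_subset⟩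
          intro i hi
          rw [mem_sdiff]
          refine ⟨hBC hi, fun hiD => ?_⟩
          exact (mem_sdiff.1 (hD hiD)).2 hi
        · intro A hA
          rw [mem_filter] at hA
          rw [sdiff_sdiff_right_self, inf_eq_inter, inter_eq_right.2 hA.2.2]
        · intro D hD
          rw [mem_powerset] at hD
          rw [sdiff_sdiff_right_self, inf_eq_inter, inter_eq_right.2 (hD.trans sdiff_subset)]
        · intro A _
          rfl
      rw [h3, h4, ← sum_mul, sum_powerset_neg_one_pow_card_real' (C \ B)]
      by_cases hCB : B = C
      · subst hCB
        simp
      · have hne : C \ B ≠ ∅ := by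
          intro h0
          apply hCB
          exact Subset.antisymm hBC (sdiff_eq_empty_iff_subset.1 h0)
        rw [if_neg hne, if_neg hCB, zero_mul]
    · have hne : B ≠ C := fun h => hBC (h ▸ Subset.refl B)
      rw [if_neg hne]
      exact sum_eq_zero fun A _ => if_neg fun h => hBC (h.1.trans h.2)
  simp_rw [h2]
  rw [Finset.sum_ite_eq univ B G, if_pos (mem_univ B)]

end Mobius

/-! ### The kernel is Sahi's functional of the coordinate indicators under the Möbius weight of its block functional -/

section KernelAsSahiE

variable (E : Fin k → Finset ι) (U : Fin k → Set (Set ι)) (ξ : Fin k → Set ι)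

/-- The **block functional** of the kernel at the copy array `ξ`: `G(B) = ∏_{i∈B} 1_{U_i}(hybrid E B ξ)`. [this work] -/
def blockFun (B : Finset (Fin k)) : ℝ := ∏ i ∈ B, ind (U i) (hybrid E B ξ)

/-- The kernel is the set-partition sum `Σ_π c_{λ(π)} E_π` of the coordinate indicators under the Möbius weight of the block
functional (each block factor `E[∏_{i∈B} χ_i]` is `G(B)` by Möbius inversion). [this work] -/
theorem kernel_eq_sum_term :
    kernel E U ξ = ∑ c : OrderedFinpartition k, term (mobius (blockFun E U ξ)) (fun i => coordInd i) c := by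
  unfold kernel term factor
  refine sum_congr rfl fun c _ => ?_
  congr 1
  refine prod_congr rfl fun m _ => ?_
  rw [ex_mobius_prod_coordInd]
  rfl

/-- **The hybrid kernel is Sahi's `E_k`** of the coordinate indicators `χ_0,…,χ_{k−1}` on the cube `Finset (Fin k)` under the
(signed) Möbius weight of its block functional: `kernel E U ξ = sahiE (mobius (blockFun E U ξ)) k χ` (`k ≥ 1`). [this work] -/
theorem kernel_eq_sahiE (E : Fin (k + 1) → Finset ι) (U : Fin (k + 1) → Set (Set ι)) (ξ : Fin (k + 1) → Set ι) :
    kernel E U ξ = sahiE (mobius (blockFun E U ξ)) (k + 1) (fun i => coordInd i) := by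
  rw [kernel_eq_sum_term, ← sahiESetPartition_eq_sum_term, ← sahiE_eq_sahiESetPartition]

end KernelAsSahiE

/-! ### The kernel at `k = 3` in closed form -/

section Three

variable (E : Fin 3 → Finset ι) (U : Fin 3 → Set (Set ι)) (ξ : Fin 3 → Set ι)

/-- **The hybrid kernel of three members**: with `G = blockFun E U ξ`,
`kernel E U ξ = 2·G{0,1,2} + G{0}·G{1}·G{2} − (G{0}·G{1,2} + G{1}·G{0,2} + G{2}·G{0,1})`
(Sahi's `E₃ = 2E_(3) − E_(2,1) + E_(1,1,1)` on the hybrids). [this work] -/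
theorem kernel_three :
    kernel E U ξ = 2 * blockFun E U ξ univ + blockFun E U ξ {0} * blockFun E U ξ {1} * blockFun E U ξ {2}
      - (blockFun E U ξ {0} * blockFun E U ξ {1, 2} + blockFun E U ξ {1} * blockFun E U ξ {0, 2}
          + blockFun E U ξ {2} * blockFun E U ξ {0, 1}) := by
  rw [kernel_eq_sahiE, sahiE_three_apply]
  set μ := mobius (blockFun E U ξ) with hμ
  have h0 : ex μ (coordInd 0) = blockFun E U ξ {0} := by
    rw [← ex_mobius_prod_coordInd (blockFun E U ξ) {0}, prod_singleton]
  have h1 : ex μ (coordInd 1) = blockFun E U ξ {1} := by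
    rw [← ex_mobius_prod_coordInd (blockFun E U ξ) {1}, prod_singleton]
  have h2 : ex μ (coordInd 2) = blockFun E U ξ {2} := by
    rw [← ex_mobius_prod_coordInd (blockFun E U ξ) {2}, prod_singleton]
  have h01 : ex μ (coordInd 0 * coordInd 1) = blockFun E U ξ {0, 1} := by
    rw [← ex_mobius_prod_coordInd (blockFun E U ξ) {0, 1}, prod_pair (by decide)]
  have h02 : ex μ (coordInd 0 * coordInd 2) = blockFun E U ξ {0, 2} := by
    rw [← ex_mobius_prod_coordInd (blockFun E U ξ) {0, 2}, prod_pair (by decide)]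
  have h12 : ex μ (coordInd 1 * coordInd 2) = blockFun E U ξ {1, 2} := by
    rw [← ex_mobius_prod_coordInd (blockFun E U ξ) {1, 2}, prod_pair (by decide)]
  have h012 : ex μ (coordInd 0 * coordInd 1 * coordInd 2) = blockFun E U ξ univ := by
    rw [← ex_mobius_prod_coordInd (blockFun E U ξ) univ, Fin.prod_univ_three]
  simp only [h0, h1, h2, h01, h02, h12, h012]

end Three

/-! ### Hybrids of singletons, pairs and the full block -/

section Hybrids

/-- The reader of a block at `e` is characterised by: it lies in the block, is interested in `e`, and dominates every interested
member of the block. [this work] -/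
theorem max'_inter_slot_eq {E : Fin k → Finset ι} {B : Finset (Fin k)} {e : ι} (h : (B ∩ slot E e).Nonempty) {j : Fin k}
    (hjB : j ∈ B) (hje : e ∈ E j) (hmax : ∀ i ∈ B, e ∈ E i → i ≤ j) : (B ∩ slot E e).max' h = j := by
  apply le_antisymm
  · have hm := Finset.max'_mem _ h
    rw [mem_inter, mem_slot] at hm
    exact hmax _ hm.1 hm.2
  · exact Finset.le_max' _ _ (mem_inter.2 ⟨hjB, mem_slot.2 hje⟩)

/-- **Hybrid of a singleton**: member `i` alone reads its own copy on its declared support: `hybrid E {i} ξ = ξ i ∩ E i`. [this work] -/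
theorem hybrid_singleton (E : Fin k → Finset ι) (i : Fin k) (ξ : Fin k → Set ι) :
    hybrid E {i} ξ = ξ i ∩ ↑(E i) := by
  ext e
  constructor
  · rintro ⟨h, he⟩
    have hm := max'_mem_inter h
    rw [mem_singleton] at hm
    refine ⟨?_, ?_⟩
    · rw [hm.1] at he; exact he
    · have := hm.2; rw [hm.1] at this; exact this
  · rintro ⟨he, hei⟩
    rw [mem_coe] at hei
    have h : (({i} : Finset (Fin k)) ∩ slot E e).Nonempty := ⟨i, mem_inter.2 ⟨mem_singleton_self i, mem_slot.2 hei⟩⟩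
    refine ⟨h, ?_⟩
    rw [max'_inter_slot_eq h (mem_singleton_self i) hei (fun i' hi' _ => (mem_singleton.1 hi').le)]
    exact he

/-- **Hybrid of a pair** `{i, j}`, `i < j`: coordinates in `E j` are read from copy `j`, the remaining coordinates of `E i` from
copy `i`: `hybrid E {i,j} ξ = (ξ j ∩ E j) ∪ ((ξ i ∩ E i) \ E j)`. [this work] -/
theorem hybrid_pair (E : Fin k → Finset ι) {i j : Fin k} (hij : i < j) (ξ : Fin k → Set ι) :
    hybrid E {i, j} ξ = (ξ j ∩ ↑(E j)) ∪ ((ξ i ∩ ↑(E i)) \ ↑(E j)) := by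
  ext e
  by_cases hej : e ∈ E j
  · -- read from `j`
    have h : (({i, j} : Finset (Fin k)) ∩ slot E e).Nonempty :=
      ⟨j, mem_inter.2 ⟨mem_insert_of_mem (mem_singleton_self j), mem_slot.2 hej⟩⟩
    have hm : (({i, j} : Finset (Fin k)) ∩ slot E e).max' h = j := by
      refine max'_inter_slot_eq h (mem_insert_of_mem (mem_singleton_self j)) hej fun i' hi' _ => ?_
      rcases mem_insert.1 hi' with rfl | hi'
      · exact hij.le
      · exact (mem_singleton.1 hi').le
    rw [mem_hybrid_iff h, hm]
    simp only [Set.mem_union, Set.mem_inter_iff, mem_coe, Set.mem_sdiff, hej, and_true, not_true, and_false, or_false]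
  · by_cases hei : e ∈ E i
    · -- read from `i`
      have h : (({i, j} : Finset (Fin k)) ∩ slot E e).Nonempty :=
        ⟨i, mem_inter.2 ⟨mem_insert_self i _, mem_slot.2 hei⟩⟩
      have hm : (({i, j} : Finset (Fin k)) ∩ slot E e).max' h = i := by
        refine max'_inter_slot_eq h (mem_insert_self i _) hei fun i' hi' he' => ?_
        rcases mem_insert.1 hi' with rfl | hi'
        · exact le_rfl
        · rw [mem_singleton] at hi'; subst hi'; exact absurd he' hej
      rw [mem_hybrid_iff h, hm]
      simp only [Set.mem_union, Set.mem_inter_iff, mem_coe, Set.mem_sdiff, hej, hei, and_true, and_false, not_false_eq_true,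
        false_or]
    · -- nobody in the pair is interested
      have h : ¬ (({i, j} : Finset (Fin k)) ∩ slot E e).Nonempty := by
        rintro ⟨x, hx⟩
        rw [mem_inter, mem_slot, mem_insert, mem_singleton] at hx
        rcases hx.1 with rfl | rfl
        · exact hei hx.2
        · exact hej hx.2
      simp only [Set.mem_union, Set.mem_inter_iff, mem_coe, Set.mem_sdiff, hej, hei, and_false, false_or, false_and,
        iff_false]
      exact not_mem_hybrid h

/-- **Hybrid of the full block of three members**: `E 2`-coordinates from copy `2`, the remaining `E 1`-coordinates from copy `1`,
the remaining `E 0`-coordinates from copy `0`. [this work] -/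
theorem hybrid_univ_three (E : Fin 3 → Finset ι) (ξ : Fin 3 → Set ι) :
    hybrid E univ ξ = (ξ 2 ∩ ↑(E 2)) ∪ ((ξ 1 ∩ ↑(E 1)) \ ↑(E 2)) ∪ ((ξ 0 ∩ ↑(E 0)) \ (↑(E 1) ∪ ↑(E 2))) := by
  ext e
  by_cases he2 : e ∈ E 2
  · have h : ((univ : Finset (Fin 3)) ∩ slot E e).Nonempty := ⟨2, mem_inter.2 ⟨mem_univ _, mem_slot.2 he2⟩⟩
    have hm : ((univ : Finset (Fin 3)) ∩ slot E e).max' h = 2 := by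
      refine max'_inter_slot_eq h (mem_univ _) he2 fun i' _ _ => ?_
      have := i'.2
      show i'.1 ≤ 2
      omega
    rw [mem_hybrid_iff h, hm]
    simp only [Set.mem_union, Set.mem_inter_iff, mem_coe, Set.mem_sdiff, he2, and_true, not_true, and_false, or_false,
      or_true, not_true, and_false, or_false]
  · by_cases he1 : e ∈ E 1
    · have h : ((univ : Finset (Fin 3)) ∩ slot E e).Nonempty := ⟨1, mem_inter.2 ⟨mem_univ _, mem_slot.2 he1⟩⟩
      have hm : ((univ : Finset (Fin 3)) ∩ slot E e).max' h = 1 := by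
        refine max'_inter_slot_eq h (mem_univ _) he1 fun i' _ he' => ?_
        rcases Fin.eq_zero_or_eq_succ i' with rfl | ⟨i'', rfl⟩
        · decide
        · rcases Fin.eq_zero_or_eq_succ i'' with rfl | ⟨i''', rfl⟩
          · decide
          · have : i''' = 0 := Fin.eq_zero i'''
            subst this
            exact absurd he' he2
      rw [mem_hybrid_iff h, hm]
      simp only [Set.mem_union, Set.mem_inter_iff, mem_coe, Set.mem_sdiff, he2, he1, and_true, and_false, not_false_eq_true,
        false_or, not_true, or_false]
    · by_cases he0 : e ∈ E 0
      · have h : ((univ : Finset (Fin 3)) ∩ slot E e).Nonempty := ⟨0, mem_inter.2 ⟨mem_univ _, mem_slot.2 he0⟩⟩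
        have hm : ((univ : Finset (Fin 3)) ∩ slot E e).max' h = 0 := by
          refine max'_inter_slot_eq h (mem_univ _) he0 fun i' _ he' => ?_
          rcases Fin.eq_zero_or_eq_succ i' with rfl | ⟨i'', rfl⟩
          · exact le_rfl
          · rcases Fin.eq_zero_or_eq_succ i'' with rfl | ⟨i''', rfl⟩
            · exact absurd he' he1
            · have : i''' = 0 := Fin.eq_zero i'''
              subst this
              exact absurd he' he2
        rw [mem_hybrid_iff h, hm]
        simp only [Set.mem_union, Set.mem_inter_iff, mem_coe, Set.mem_sdiff, he2, he1, he0, and_true, and_false,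
          not_false_eq_true, false_or, or_self]
      · have h : ¬ ((univ : Finset (Fin 3)) ∩ slot E e).Nonempty := by
          rintro ⟨x, hx⟩
          rw [mem_inter, mem_slot] at hx
          rcases Fin.eq_zero_or_eq_succ x with rfl | ⟨x', rfl⟩
          · exact he0 hx.2
          · rcases Fin.eq_zero_or_eq_succ x' with rfl | ⟨x'', rfl⟩
            · exact he1 hx.2
            · have : x'' = 0 := Fin.eq_zero x''
              subst this
              exact he2 hx.2
        simp only [Set.mem_union, Set.mem_inter_iff, mem_coe, Set.mem_sdiff, he2, he1, he0, and_false, false_or,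
          false_and, iff_false]
        exact not_mem_hybrid h

end Hybrids

end SahiHybrid

end Summit.CriticalPhenomena.PercolationContinuityZ3.Theorems
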